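import Mathlib
import Summits.Ventures.PercRepro2.Graph
import Summits.Ventures.PercRepro2.Exploration
import Summits.Ventures.PercRepro2.Harris
import Summits.Ventures.PercRepro2.GibbsPAJoint
import Summits.Ventures.PercRepro2.GibbsPAq
import Summits.Ventures.PercRepro2.SepClusterJoint
import Summits.Ventures.PercRepro2.SepClusterSupport
import Summits.Ventures.PercRepro2.SepClusterHarris
import Summits.Ventures.PercRepro2.SepFamJoint
import Summits.Ventures.PercRepro2.SepFamSupport
import Summits.Ventures.PercRepro2.SepFamHarris
import Summits.Ventures.PercRepro2.SepFamPA
import Summits.Ventures.PercRepro2.SepFamCross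
import Summits.Ventures.PercRepro2.SepFamClosed
import Summits.Ventures.PercRepro2.SepFamClosedAB

/-!
# The joint mixed-order positive association of the two separated explorations — BHK06 Theorem 2.1
at `q = 1` for root sets, in full (blind cell PercRepro2, p3 g13, 2026-08-27; `proofs/P3-G2.md` §7′)

Van den Berg–Häggström–Kahn, *Some conditional correlation inequalities for percolation and related
processes*, Random Structures & Algorithms 29 (2006), doi:10.1002/rsa.20102, Theorem 2.1 (random-cluster
measure with `q ≥ 1`; `q = 1` is bond percolation): for disjoint root sets `X, Y` and functions `H₁, H₂`
of the pair of explorations, each increasing in the `X`-side and decreasing in the `Y`-side,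
`E[H₁ H₂ | X ↮ Y] ≥ E[H₁ | X ↮ Y] · E[H₂ | X ↮ Y]`.  The tree holds the two one-sided faces of this
statement for root sets (`sep_fam_pa`: both functions of the `Y`-tuple; `sep_fam_cross`: one function of
each side) and the single-root joint form (`BHKPair.bhk_pair`); this file proves the JOINT form for root
sets, with the tuple of clusters `expl` as the explored object, multiplied out:

  `E[1_S H₁(expl Y, expl X)] · E[1_S H₂(expl Y, expl X)] ≤ P(S) · E[1_S (H₁ H₂)(expl Y, expl X)]`,

`S = sepFam X Y = {X ↮ Y}`, for `H_i : (Y → Set V) → (X → Set V) → ℝ` antitone in the `Y`-tuple and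
monotone in the `X`-tuple (`sep_fam_mixed`, weights in `(0,1)`; `sep_fam_mixed_closed`, all weights in
`[0,1]`).  Proof (BHK06's Lemma 2.6 once): condition on the `Y`-tuple `t`; on the fibre the `X`-tuple is
the exploration of `X` in `G − foot t` under the product law, so the two monotone functions `H_i(t, ·)`
are positively associated (`harris_left_fam`); the fibre means `B_i(t) = E[H_i(t, expl X of G − foot t)]`
are antitone in `t` (a larger explored `Y`-tuple shrinks the graph and lowers `H_i`), so Theorem A on the
`Y`-side (`cov_nonneg_incYf`) makes their covariance non-negative.  Both faces in the tree are the special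
cases `H_i` independent of one argument.  Own work on the cell's `SepPA` chain; standard axioms.
-/

namespace Summit.Ventures.PercRepro2

namespace SepPA

open Finset Classical

section FamilyMixed

variable {V : Type*} {E : Type*} [Fintype V] [Fintype E] [DecidableEq E]
variable (ends : E → Sym2 V) (p : E → ℝ) {X Y : Finset V}

/-- The expectation of `1_S · H(expl Y, expl X)` through the joint law `Jf`. -/
lemma expect_indicator_expl_joint (hp01 : ∀ e, 0 < p e ∧ p e < 1) (hXY : Disjoint X Y)
    (H : (Y → Set V) → (X → Set V) → ℝ) :
    expect p (fun ω => (sepFam ends X Y).indicator (fun _ => (1 : ℝ)) ω *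
        H (expl ends ω Y) (expl ends ω X))
      = prob p (sepFam ends X Y) * ∑ t, ∑ k, Jf ends p X Y t k * H t k := by
  have hS : prob p (sepFam ends X Y) ≠ 0 := ne_of_gt (prob_sepFam_pos ends p hp01 hXY)
  have h := expect_indicator_comp_eq_sum p (sepFam ends X Y)
    (fun ω => (expl ends ω Y, expl ends ω X)) (fun tk => H tk.1 tk.2)
  simp only at h
  rw [h, Fintype.sum_prod_type, Finset.mul_sum]
  apply Finset.sum_congr rfl
  intro t _
  rw [Finset.mul_sum]
  apply Finset.sum_congr rfl
  intro k _
  unfold Jf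
  have : sepFam ends X Y ∩ {ω | (expl ends ω Y, expl ends ω X) = (t, k)} =
      explEvent ends Y t ∩ explEvent ends X k ∩ sepFam ends X Y := by
    ext ω
    simp only [Set.mem_inter_iff, Set.mem_setOf_eq, Prod.mk.injEq, explEvent_eq_preimage]
    tauto
  rw [this]
  field_simp

/-- `q_t · E[H(t, ·) | t] = ∑_k Jf t k · H t k`, in all cases. -/
lemma marg_mul_condMeanY (hp01 : ∀ e, 0 < p e ∧ p e < 1)
    (H : (Y → Set V) → (X → Set V) → ℝ) (t : Y → Set V) :
    (∑ k, Jf ends p X Y t k) *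
        GibbsPAJoint.condS (GibbsPAJoint.transpose (Jf ends p X Y)) (fun k => H t k) t =
      ∑ k, Jf ends p X Y t k * H t k := by
  unfold GibbsPAJoint.condS GibbsPAJoint.transpose
  by_cases hq : (∑ k, Jf ends p X Y t k) = 0
  · have hz : ∀ k, Jf ends p X Y t k = 0 :=
      GibbsPAJoint.all_zero_of_sum_eq_zero' (Jf_nonneg ends p hp01) hq
    simp [hz]
  · rw [mul_div_cancel₀ _ hq]

/-- On the support, the conditional mean is the expectation of `H(t, ·)` on the exploration of `X`
in `G − foot t` (domain Markov). -/
lemma condMeanY_eq_expect (hp01 : ∀ e, 0 < p e ∧ p e < 1) (hXY : Disjoint X Y)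
    (H : (Y → Set V) → (X → Set V) → ℝ) {t : Y → Set V}
    (ht : (∑ k, Jf ends p X Y t k) ≠ 0) :
    GibbsPAJoint.condS (GibbsPAJoint.transpose (Jf ends p X Y)) (fun k => H t k) t =
      expect p (fun ω => H t (explAway ends X (foot t) ω)) := by
  exact condS_transpose_eq_expect_fam ends p hp01 hXY (fun k => H t k) ht

/-- For `H` antitone in the `Y`-tuple and monotone in the `X`-tuple, the conditional mean
`t ↦ E[H(t, expl X) | expl Y = t]` is antitone on the support: its negative is `IncYf`. -/
lemma incYf_neg_condMeanY (hp01 : ∀ e, 0 < p e ∧ p e < 1) (hXY : Disjoint X Y)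
    {H : (Y → Set V) → (X → Set V) → ℝ} (hHt : ∀ k, Antitone (fun t => H t k))
    (hHk : ∀ t, Monotone (fun k => H t k)) :
    IncYf ends p X Y (fun t =>
      -(GibbsPAJoint.condS (GibbsPAJoint.transpose (Jf ends p X Y)) (fun k => H t k) t)) := by
  intro t t' ht ht' htt'
  simp only
  rw [condMeanY_eq_expect ends p hp01 hXY H ht, condMeanY_eq_expect ends p hp01 hXY H ht']
  have : expect p (fun ω => H t' (explAway ends X (foot t') ω)) ≤
      expect p (fun ω => H t (explAway ends X (foot t) ω)) := by
    apply expect_mono (isProbVec_of_interior p hp01)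
    intro ω
    calc H t' (explAway ends X (foot t') ω) ≤ H t (explAway ends X (foot t') ω) :=
          hHt (explAway ends X (foot t') ω) htt'
      _ ≤ H t (explAway ends X (foot t) ω) :=
          hHk t (explAway_anti ends X (foot_mono htt') ω)
  linarith

/-- **Conditional Harris on the fibre over the `Y`-tuple, for joint functions monotone in the
`X`-tuple.** -/
lemma harris_fibre_joint (hp01 : ∀ e, 0 < p e ∧ p e < 1) (hXY : Disjoint X Y)
    (H₁ H₂ : (Y → Set V) → (X → Set V) → ℝ)
    (h₁ : ∀ t, Monotone (fun k => H₁ t k)) (h₂ : ∀ t, Monotone (fun k => H₂ t k))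
    (t : Y → Set V) :
    (∑ k, Jf ends p X Y t k * H₁ t k) * (∑ k, Jf ends p X Y t k * H₂ t k) ≤
      (∑ k, Jf ends p X Y t k * (H₁ t k * H₂ t k)) * (∑ k, Jf ends p X Y t k) := by
  have hA₁ : AntiXf ends p X Y (fun k => -(H₁ t k)) := by
    intro k k' _ _ hkk'
    simp only
    linarith [h₁ t hkk']
  have hA₂ : AntiXf ends p X Y (fun k => -(H₂ t k)) := by
    intro k k' _ _ hkk'
    simp only
    linarith [h₂ t hkk']
  have h := harris_left_fam ends p hp01 hXY _ _ hA₁ hA₂ t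
  simp only [mul_neg, Finset.sum_neg_distrib, neg_mul, neg_neg] at h
  exact h

/-- **BHK06 Theorem 2.1 at `q = 1`, for root sets (the joint mixed-order form).**  For disjoint
`X, Y`, weights in `(0,1)`, and `H₁ H₂ : (Y → Set V) → (X → Set V) → ℝ` each antitone
in the `Y`-tuple and monotone in the `X`-tuple:
`E[1_S H₁] · E[1_S H₂] ≤ P(S) · E[1_S H₁ H₂]`, `S = {X ↮ Y}`, the `H_i` evaluated at
`(expl Y, expl X)`. -/
theorem sep_fam_mixed (hp01 : ∀ e, 0 < p e ∧ p e < 1) (hXY : Disjoint X Y)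
    (H₁ H₂ : (Y → Set V) → (X → Set V) → ℝ)
    (h₁t : ∀ k, Antitone (fun t => H₁ t k)) (h₁k : ∀ t, Monotone (fun k => H₁ t k))
    (h₂t : ∀ k, Antitone (fun t => H₂ t k)) (h₂k : ∀ t, Monotone (fun k => H₂ t k)) :
    expect p (fun ω => (sepFam ends X Y).indicator (fun _ => (1 : ℝ)) ω *
        H₁ (expl ends ω Y) (expl ends ω X)) *
      expect p (fun ω => (sepFam ends X Y).indicator (fun _ => (1 : ℝ)) ω *
        H₂ (expl ends ω Y) (expl ends ω X)) ≤
    prob p (sepFam ends X Y) *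
      expect p (fun ω => (sepFam ends X Y).indicator (fun _ => (1 : ℝ)) ω *
        (H₁ (expl ends ω Y) (expl ends ω X) * H₂ (expl ends ω Y) (expl ends ω X))) := by
  have hJ0 : ∀ t k, 0 ≤ Jf ends p X Y t k := Jf_nonneg ends p hp01
  -- the tower identities
  have tower₁ : ∑ t, ∑ k, Jf ends p X Y t k * H₁ t k =
      ∑ t, (∑ k, Jf ends p X Y t k) *
        GibbsPAJoint.condS (GibbsPAJoint.transpose (Jf ends p X Y)) (fun k => H₁ t k) t := by
    apply Finset.sum_congr rfl
    intro t _
    rw [marg_mul_condMeanY ends p hp01 H₁ t]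
  have tower₂ : ∑ t, ∑ k, Jf ends p X Y t k * H₂ t k =
      ∑ t, (∑ k, Jf ends p X Y t k) *
        GibbsPAJoint.condS (GibbsPAJoint.transpose (Jf ends p X Y)) (fun k => H₂ t k) t := by
    apply Finset.sum_congr rfl
    intro t _
    rw [marg_mul_condMeanY ends p hp01 H₂ t]
  -- the fibre step: conditional positive association on every fibre
  have fibre : ∑ t, (∑ k, Jf ends p X Y t k) *
      (GibbsPAJoint.condS (GibbsPAJoint.transpose (Jf ends p X Y)) (fun k => H₁ t k) t *
        GibbsPAJoint.condS (GibbsPAJoint.transpose (Jf ends p X Y)) (fun k => H₂ t k) t) ≤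
      ∑ t, ∑ k, Jf ends p X Y t k * (H₁ t k * H₂ t k) := by
    apply Finset.sum_le_sum
    intro t _
    by_cases hq : (∑ k, Jf ends p X Y t k) = 0
    · have hz : ∀ k, Jf ends p X Y t k = 0 := GibbsPAJoint.all_zero_of_sum_eq_zero' hJ0 hq
      rw [hq, zero_mul]
      apply Finset.sum_nonneg
      intro k _
      rw [hz k, zero_mul]
    · have hqpos : 0 < ∑ k, Jf ends p X Y t k :=
        lt_of_le_of_ne (Finset.sum_nonneg (fun k _ => hJ0 t k)) (Ne.symm hq)
      have e : (∑ k, Jf ends p X Y t k) *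
          (GibbsPAJoint.condS (GibbsPAJoint.transpose (Jf ends p X Y)) (fun k => H₁ t k) t *
            GibbsPAJoint.condS (GibbsPAJoint.transpose (Jf ends p X Y)) (fun k => H₂ t k) t) =
          ((∑ k, Jf ends p X Y t k * H₁ t k) * (∑ k, Jf ends p X Y t k * H₂ t k)) /
            (∑ k, Jf ends p X Y t k) := by
        rw [← marg_mul_condMeanY ends p hp01 H₁ t, ← marg_mul_condMeanY ends p hp01 H₂ t]
        field_simp
      rw [e, div_le_iff₀ hqpos]
      exact harris_fibre_joint ends p hp01 hXY H₁ H₂ h₁k h₂k t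
  -- Theorem A on the `Y` side for the negated conditional means
  have hcov := cov_nonneg_incYf ends p hp01 hXY
    (fun t => -(GibbsPAJoint.condS (GibbsPAJoint.transpose (Jf ends p X Y)) (fun k => H₁ t k) t))
    (fun t => -(GibbsPAJoint.condS (GibbsPAJoint.transpose (Jf ends p X Y)) (fun k => H₂ t k) t))
    (incYf_neg_condMeanY ends p hp01 hXY h₁t h₁k)
    (incYf_neg_condMeanY ends p hp01 hXY h₂t h₂k)
  unfold GibbsPAq.cov at hcov
  simp only [mul_neg, Finset.sum_neg_distrib, neg_mul, neg_neg] at hcov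
  rw [expect_indicator_expl_joint ends p hp01 hXY H₁,
    expect_indicator_expl_joint ends p hp01 hXY H₂,
    expect_indicator_expl_joint ends p hp01 hXY (fun t k => H₁ t k * H₂ t k), tower₁,
    tower₂]
  have hS0 : 0 ≤ prob p (sepFam ends X Y) := le_of_lt (prob_sepFam_pos ends p hp01 hXY)
  have key : (∑ t, (∑ k, Jf ends p X Y t k) *
        GibbsPAJoint.condS (GibbsPAJoint.transpose (Jf ends p X Y)) (fun k => H₁ t k) t) *
      (∑ t, (∑ k, Jf ends p X Y t k) *
        GibbsPAJoint.condS (GibbsPAJoint.transpose (Jf ends p X Y)) (fun k => H₂ t k) t) ≤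
      ∑ t, ∑ k, Jf ends p X Y t k * (H₁ t k * H₂ t k) := by
    linarith
  have := mul_le_mul_of_nonneg_left key (mul_nonneg hS0 hS0)
  nlinarith [this]

/-- **BHK06 Theorem 2.1 at `q = 1` for root sets, all edge weights in `[0, 1]`.** -/
theorem sep_fam_mixed_closed (hp : ∀ e, 0 ≤ p e ∧ p e ≤ 1) (hXY : Disjoint X Y)
    (H₁ H₂ : (Y → Set V) → (X → Set V) → ℝ)
    (h₁t : ∀ k, Antitone (fun t => H₁ t k)) (h₁k : ∀ t, Monotone (fun k => H₁ t k))
    (h₂t : ∀ k, Antitone (fun t => H₂ t k)) (h₂k : ∀ t, Monotone (fun k => H₂ t k)) :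
    expect p (fun ω => (sepFam ends X Y).indicator (fun _ => (1 : ℝ)) ω *
        H₁ (expl ends ω Y) (expl ends ω X)) *
      expect p (fun ω => (sepFam ends X Y).indicator (fun _ => (1 : ℝ)) ω *
        H₂ (expl ends ω Y) (expl ends ω X)) ≤
    prob p (sepFam ends X Y) *
      expect p (fun ω => (sepFam ends X Y).indicator (fun _ => (1 : ℝ)) ω *
        (H₁ (expl ends ω Y) (expl ends ω X) * H₂ (expl ends ω Y) (expl ends ω X))) := by
  let F : (E → ℝ) → ℝ := fun q =>
    prob q (sepFam ends X Y) *
      expect q (fun ω => (sepFam ends X Y).indicator (fun _ => (1 : ℝ)) ω *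
        (H₁ (expl ends ω Y) (expl ends ω X) * H₂ (expl ends ω Y) (expl ends ω X))) -
    expect q (fun ω => (sepFam ends X Y).indicator (fun _ => (1 : ℝ)) ω *
        H₁ (expl ends ω Y) (expl ends ω X)) *
      expect q (fun ω => (sepFam ends X Y).indicator (fun _ => (1 : ℝ)) ω *
        H₂ (expl ends ω Y) (expl ends ω X))
  have hF : Continuous F :=
    ((continuous_prob _).mul (continuous_expect _)).sub
      ((continuous_expect _).mul (continuous_expect _))
  have h := nonneg_of_nonneg_interior F hF p hp (fun q hq => by
    have := sep_fam_mixed ends q hq hXY H₁ H₂ h₁t h₁k h₂t h₂k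
    simp only [F]
    linarith)
  simp only [F] at h
  linarith

/-- The event form: for an increasing event `A` of the `X`-tuple and a DEcreasing event `B` of the
`Y`-tuple (an up-set, resp. a down-set, of tuples),
`P(S) · P(S ∧ A ∧ B) ≥ P(S ∧ A) · P(S ∧ B)` — the
indicators `1_A(expl X) · 1_B(expl Y)` are mixed-order monotone.  (The faces `sep_fam_pa` /
`sep_fam_cross` of the tree are the cases of `sep_fam_mixed` with one argument idle.) -/
theorem sep_fam_mixed_indicator (hp : ∀ e, 0 ≤ p e ∧ p e ≤ 1) (hXY : Disjoint X Y)
    (A : Set (X → Set V)) (B : Set (Y → Set V)) (hA : IsUpperSet A) (hB : IsLowerSet B)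
    (A' : Set (X → Set V)) (B' : Set (Y → Set V)) (hA' : IsUpperSet A') (hB' : IsLowerSet B') :
    expect p (fun ω => (sepFam ends X Y).indicator (fun _ => (1 : ℝ)) ω *
        (B.indicator (fun _ => (1 : ℝ)) (expl ends ω Y) *
          A.indicator (fun _ => (1 : ℝ)) (expl ends ω X))) *
      expect p (fun ω => (sepFam ends X Y).indicator (fun _ => (1 : ℝ)) ω *
        (B'.indicator (fun _ => (1 : ℝ)) (expl ends ω Y) *
          A'.indicator (fun _ => (1 : ℝ)) (expl ends ω X))) ≤
    prob p (sepFam ends X Y) *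
      expect p (fun ω => (sepFam ends X Y).indicator (fun _ => (1 : ℝ)) ω *
        ((B.indicator (fun _ => (1 : ℝ)) (expl ends ω Y) *
            A.indicator (fun _ => (1 : ℝ)) (expl ends ω X)) *
          (B'.indicator (fun _ => (1 : ℝ)) (expl ends ω Y) *
            A'.indicator (fun _ => (1 : ℝ)) (expl ends ω X)))) := by
  have hind : ∀ (A : Set (X → Set V)) (B : Set (Y → Set V)), IsUpperSet A → IsLowerSet B →
      (∀ k, Antitone (fun t => B.indicator (fun _ => (1 : ℝ)) t *
          A.indicator (fun _ => (1 : ℝ)) k)) ∧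
      (∀ t, Monotone (fun k => B.indicator (fun _ => (1 : ℝ)) t *
          A.indicator (fun _ => (1 : ℝ)) k)) := by
    intro A B hA hB
    constructor
    · intro k t t' htt'
      simp only
      apply mul_le_mul_of_nonneg_right _ (Set.indicator_nonneg (fun _ _ => zero_le_one) _)
      by_cases ht' : t' ∈ B
      · have ht : t ∈ B := hB htt' ht'
        simp [ht, ht']
      · simp [ht', Set.indicator_nonneg (fun _ _ => zero_le_one)]
    · intro t k k' hkk'
      simp only
      apply mul_le_mul_of_nonneg_left _ (Set.indicator_nonneg (fun _ _ => zero_le_one) _)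
      by_cases hk : k ∈ A
      · have hk' : k' ∈ A := hA hkk' hk
        simp [hk, hk']
      · simp [hk, Set.indicator_nonneg (fun _ _ => zero_le_one)]
  obtain ⟨h₁t, h₁k⟩ := hind A B hA hB
  obtain ⟨h₂t, h₂k⟩ := hind A' B' hA' hB'
  exact sep_fam_mixed_closed ends p hp hXY _ _ h₁t h₁k h₂t h₂k

end FamilyMixed

end SepPA

end Summit.Ventures.PercRepro2
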